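import Summits.QuantumFields.QCD.Theorems.WilsonMobilityGapChiralMobilityGapOfAnchorCore

/-!
# Crux `ChiralMobilityGap` (stmt-QuantumFields-17497) — line `Ideator3Sketch` (card `sign-threshold-anchor`)
# SKELETON v9 (lead prover-line-stmt-QuantumFields-17497-c4-0): the four physical stubs ARE the named
# `@[conjecture]` nodes; the composition is the LANDED conditional closer by name

History: v1–v4 (c0/c1: anchored witness made explicit; (i), (iv), scalings, `N_f = 3` sign input, super-log volumes,
transfer landed), v5–v8 (c2: diagonal/split reshape in the (1,2)-moment currency; glue A p140335, glue B′ p140812,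
sandwich p142602 landed; four PHYSICAL stubs, one physical claim each; c3 re-registered v8 unchanged after wave 4).

v9 (this lead, crux cycle 5).  Nothing about the mathematics changed: five lead cycles and four stub-worker waves concur
that the four stubs are constructive lattice QCD along an asymptotically free Wilson trajectory (hadron-mass bounds in
physical units, uniform in the volume) with no supplier in print, tree, stockroom or corpus, and that no reshape inside
any witness design lowers that content (clause (iii) + `HasMassScaling` pin `m_crit(k)` to `m_c(β_k) + O(a_k/Z_m)`;
barriers `HoppingExpansionUniformGap`, `PerturbativeInvisibility`).  What changed is the BOOKKEEPING: the stubs are now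
the importable named conjectures of `Theorems/WilsonMobilityGapChiralMobilityGapAnchorCoreDefs.lean` (p173706) —
`AnchorPionCeiling`, `AnchorFloorFinite`, `AnchorFloorChiral`, `AnchorSplit` (each `Iff.rfl`-equal to the v8 signature:
`anchorPionCeiling_iff` etc.) — and the composition §4 of v8 is LANDED as the registered sub-goal
`chiralMobilityGap_of_anchorNodes : AnchorPionCeiling → AnchorFloorFinite → AnchorFloorChiral → AnchorSplit →
ChiralMobilityGap` (`Theorems/WilsonMobilityGapChiralMobilityGapOfAnchorCore.lean`), together with the kill route of the
chirality node `not_anchorFloorChiral_of_uniformAxisCeiling` (a `t`-uniform pion-ceiling rate along one `N_f` refutes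
`AnchorFloorChiral`, by the sandwich p142602).  So this skeleton is four `sorry`s typed by NAME and one line; the crux is
kernel-closed modulo exactly the four named nodes, which provers / refuters / grounders can now address from `Theorems/`.

Stubs (4 ≤ stubs_max), all PHYSICAL, all OPEN: `stub_pionCeiling : AnchorPionCeiling`, `stub_floorFinite :
AnchorFloorFinite`, `stub_floorChiral : AnchorFloorChiral`, `stub_split : AnchorSplit`.
-/

noncomputable section

namespace Summit.QuantumFields.QCD.Theorems.ChiralMobilityGapAnchor

/-! ### §1 The four physical stubs, typed by their node names (texts: `…AnchorCoreDefs.lean` docstrings) -/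

/-- PHYSICAL STUB 1 — **pion-correlator ceiling at a physical rate** along the anchored degenerate trajectories, for
every renormalised mass `t > 0`, uniformly in the volume, eventually in the cutoff (node `AnchorPionCeiling`; unfolds by
`anchorPionCeiling_iff` to the v8 signature).  OPEN: a hadron-mass LOWER bound in physical units along an
asymptotically free Wilson trajectory. -/
theorem stub_pionCeiling : AnchorPionCeiling := by
  sorry

/-- PHYSICAL STUB 2a — **first-moment floor at a finite physical rate** for every renormalised mass `t > 0` (node
`AnchorFloorFinite`; `anchorFloorFinite_iff`).  OPEN: "quarks of renormalised mass `t` are not lattice-heavy at the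
anchor" — a hadronic-mass UPPER bound in physical units. -/
theorem stub_floorFinite : AnchorFloorFinite := by
  sorry

/-- PHYSICAL STUB 2b — **first-moment floors at arbitrarily small physical rate** (node `AnchorFloorChiral`;
`anchorFloorChiral_iff`).  OPEN: "the sign anchor IS the chiral critical line to `o(a_k/Z_m)`"; refutable through
`not_anchorFloorChiral_of_uniformAxisCeiling`. -/
theorem stub_floorChiral : AnchorFloorChiral := by
  sorry

/-- PHYSICAL STUB 3 — **clauses (ii)/(iii) at split positive tuples** along the anchored witness (node `AnchorSplit`;
`anchorSplit_iff`).  OPEN: no volume-uniform transfer from the diagonal exists. -/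
theorem stub_split : AnchorSplit := by
  sorry

/-! ### §2 Composition: the crux BY NAME through the landed conditional closer -/

/-- **THE COMPOSITION: `ChiralMobilityGap` (stmt-QuantumFields-17497) BY NAME** — the landed
`chiralMobilityGap_of_anchorNodes` applied to the four stubs (witness `anchorReg N_f`). -/
theorem ChiralMobilityGap_of : Summit.QuantumFields.QCD.Theses.WilsonMobilityGap.ChiralMobilityGap :=
  chiralMobilityGap_of_anchorNodes stub_pionCeiling stub_floorFinite stub_floorChiral stub_split

end Summit.QuantumFields.QCD.Theorems.ChiralMobilityGapAnchor

end
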